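import Summits.QuantumAdvantage.AdviceFreeQNC0.BondTwist
import Summits.QuantumAdvantage.AdviceFreeQNC0.LinFormsRegular
import Literature.Computability.MetaComplexity.LinearFormsRegularisation
import Mathlib.Analysis.SpecificLimits.Basic
import HarnessLib

/-!
# Cell qa-qnc0, rung F-Q2-odd (`p = 3`), planner qa-qnc0-p1 g20 — rung R-lin3: the GLUE
(ROUND-19 §3; `exp20/Sketch20x.lean` §2–§3, definitions VERBATIM; ask P-20a(2)–(3), glue parts)

Statements `RingJuntaBellsSharp3`, `RingWindowBellsSharp3`, `RingLinFormsSharp3`, `RingLinFormsLt3` (Sketch20x §2–§3,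
verbatim) and the three glue steps of rung R-lin3 ("tables of polylog many linear forms mod 3"):

* `ringJuntaBellsSharp3_of_window : RingWindowBellsSharp3 → RingJuntaBellsSharp3` — pigeonhole: a junta `J` with
  `m(|J|+1) ≤ N` leaves one of the `|J|+1` windows `[tm, tm+m)` free, and a `J`-measurable bell set is measurable
  w.r.t. the bits outside that window;
* `ringLinFormsSharp3_of : TwistBoundX3 → RingJuntaBellsSharp3 → RingLinFormsSharp3` — the R11′ template: ONE call
  of qn-lit's generic regularise–expand inequality `LinForms.card_le_junta_add_twist` with
  `P v x := OddZeros x ∧ Rel x (t(x) ⊕ tab(v))`, `w = 8K + 2m₁`, MAIN `= (2/3 + ε/2)·2^{N−1}` (junta-selected bells),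
  ERROR `= 3^K·|A|·(√3/2)^w·2^N ≤ (ε/2)·2^{N−1}` since `3·(√3/2)^8 = 243/256 < 1`;
* `ringLinFormsLt3_of_sharp` (planner's, verbatim): `θ = 5/6`.

So `RingLinFormsLt3` now depends exactly on the two open analytic/combinatorial inputs `TwistBoundX3` (Sketch20x §1;
per-site contraction landed in `BondTwist.lean`) and `RingWindowBellsSharp3` (§2).

WHAT THIS IS NOT: neither input is proved here; crux 22907 untouched; separation NOT moved.
-/

noncomputable section

namespace Summit.QuantumAdvantage.AdviceFreeQNC0

open Finset Literature.Computability.QuantumComplexity Literature.Computability.MetaComplexity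

namespace BondTwist3

/-! ## §2 Junta-selected bell sets (Sketch20x §2, verbatim) -/

/-- **`RingJuntaBellsSharp3`**: a bell set `B(x)` depending on `x` only through a common junta `J` with `m(ε)·(|J|+1) ≤ N`
wins on `≤ (2/3 + ε)·2^{N−1}` odd inputs.  (Sketch20x §2, verbatim.) -/
def RingJuntaBellsSharp3 : Prop :=
  open scoped Classical in
  ∀ ε : ℝ, 0 < ε → ∃ m : ℕ, ∀ (N : ℕ) (J : Finset (Fin N)), m * (J.card + 1) ≤ N →
    ∀ B : (Fin N → Bool) → Finset (Fin N),
      (∀ x y : Fin N → Bool, (∀ i ∈ J, x i = y i) → B x = B y) →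
        ((univ.filter fun x : Fin N → Bool =>
            OddZeros x ∧ RingHLF.Rel x (fun k => xor (tGuess x k) (decide (k ∈ B x)))).card : ℝ)
          ≤ (2 / 3 + ε) * (2 : ℝ) ^ (N - 1)

/-- **`RingWindowBellsSharp3`** (R0 ∨ E2 on a free window): if the bell set `B(x)` is measurable w.r.t. the bits OUTSIDE a
window `[a, a+L)`, `L ≥ L₀(ε)`, the strategy wins on `≤ (2/3 + ε)·2^{N−1}` odd inputs.  (Sketch20x §2, verbatim; NOT proved
here.) -/
def RingWindowBellsSharp3 : Prop :=
  open scoped Classical in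
  ∀ ε : ℝ, 0 < ε → ∃ L₀ : ℕ, ∀ (N a L : ℕ), L₀ ≤ L → a + L ≤ N →
    ∀ B : (Fin N → Bool) → Finset (Fin N),
      (∀ x y : Fin N → Bool, (∀ i : Fin N, (i.val < a ∨ a + L ≤ i.val) → x i = y i) → B x = B y) →
        ((univ.filter fun x : Fin N → Bool =>
            OddZeros x ∧ RingHLF.Rel x (fun k => xor (tGuess x k) (decide (k ∈ B x)))).card : ℝ)
          ≤ (2 / 3 + ε) * (2 : ℝ) ^ (N - 1)

/-- Pigeonhole for a free window: among the `T` disjoint windows `[tS, tS + S)`, `t < T`, with `T` exceeding the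
number of marked points, one contains no marked point. -/
theorem exists_free_window {N : ℕ} (M : Finset (Fin N)) (S T : ℕ) (hS : 0 < S) (hT : M.card < T) :
    ∃ t, t < T ∧ ∀ i ∈ M, ¬ (t * S ≤ i.val ∧ i.val < t * S + S) := by
  have hex : ∃ t ∈ range T, t ∉ M.image fun i : Fin N => i.val / S := by
    by_contra hall
    push Not at hall
    have hsub : range T ⊆ M.image fun i : Fin N => i.val / S := fun t ht => hall t ht
    have h1 := card_le_card hsub
    rw [card_range] at h1
    have h2 := card_image_le (s := M) (f := fun i : Fin N => i.val / S)
    omega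
  obtain ⟨t, ht, hnot⟩ := hex
  refine ⟨t, mem_range.1 ht, fun i hi hin => hnot ?_⟩
  rw [mem_image]
  refine ⟨i, hi, ?_⟩
  have h1 : t ≤ i.val / S := (Nat.le_div_iff_mul_le hS).2 (by omega)
  have h2 : i.val / S < t + 1 := (Nat.div_lt_iff_lt_mul hS).2 (by rw [add_mul, one_mul]; omega)
  omega

/-- **Glue** (Sketch20x §2 `ringJuntaBellsSharp3_of_window`): the complement of a junta `J` with `m(|J|+1) ≤ N`
contains a window of length `m`, and a `J`-measurable bell set is measurable w.r.t. the bits outside that window. -/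
theorem ringJuntaBellsSharp3_of_window (h : RingWindowBellsSharp3) : RingJuntaBellsSharp3 := by
  intro ε hε
  obtain ⟨L₀, hL₀⟩ := h ε hε
  refine ⟨L₀ + 1, fun N J hJ B hB => ?_⟩
  obtain ⟨t, ht, hfree⟩ := exists_free_window J (L₀ + 1) (J.card + 1) (by omega) (by omega)
  have hfit : t * (L₀ + 1) + (L₀ + 1) ≤ N := by
    have : (t + 1) * (L₀ + 1) ≤ (J.card + 1) * (L₀ + 1) := Nat.mul_le_mul_right _ ht
    rw [mul_comm (J.card + 1)] at this
    rw [add_mul, one_mul] at this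
    omega
  refine hL₀ N (t * (L₀ + 1)) (L₀ + 1) (by omega) hfit B fun x y hxy => hB x y fun i hi => hxy i ?_
  have := hfree i hi
  omega

/-! ## §3 Rung R-lin3 (Sketch20x §3, verbatim) -/

/-- **`RingLinFormsSharp3`** (rung R-lin3, sharp form): bells `b_k(x) = tab k (⟨λ_1,x⟩, …, ⟨λ_K,x⟩ mod 3)` with
`K ≤ (log₂ N)^C` and ARBITRARY tables win on `≤ (2/3 + ε)·2^{N−1}` odd inputs (`N ≥ n₀(ε, C)`).  (Sketch20x §3,
verbatim.) -/
def RingLinFormsSharp3 : Prop :=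
  open scoped Classical in
  ∀ ε : ℝ, 0 < ε → ∀ C : ℕ, ∃ n₀ : ℕ, ∀ N ≥ n₀, ∀ K : ℕ, K ≤ (Nat.log 2 N) ^ C →
    ∀ (lam : Fin K → Fin N → ZMod 3) (tab : Fin N → (Fin K → ZMod 3) → Bool),
      ((univ.filter fun x : Fin N → Bool =>
          OddZeros x ∧ RingHLF.Rel x (fun k => xor (tGuess x k) (tab k (LinForms.resVec lam x)))).card : ℝ)
        ≤ (2 / 3 + ε) * (2 : ℝ) ^ (N - 1)

/-- **`RingLinFormsLt3`** (rung R-lin3, route-facing `θ < 1` form).  (Sketch20x §3, verbatim.) -/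
def RingLinFormsLt3 : Prop :=
  open scoped Classical in
  ∃ θ : ℝ, θ < 1 ∧ ∀ C : ℕ, ∃ n₀ : ℕ, ∀ N ≥ n₀, ∀ K : ℕ, K ≤ (Nat.log 2 N) ^ C →
    ∀ (lam : Fin K → Fin N → ZMod 3) (tab : Fin N → (Fin K → ZMod 3) → Bool),
      ((univ.filter fun x : Fin N → Bool =>
          OddZeros x ∧ RingHLF.Rel x (fun k => xor (tGuess x k) (tab k (LinForms.resVec lam x)))).card : ℝ)
        ≤ θ * (2 : ℝ) ^ (N - 1)

/-- glue: sharp ⇒ `θ = 5/6` (planner's proof, verbatim). -/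
theorem ringLinFormsLt3_of_sharp (h : RingLinFormsSharp3) : RingLinFormsLt3 := by
  classical
  refine ⟨5 / 6, by norm_num, fun C => ?_⟩
  obtain ⟨n₀, hn₀⟩ := h (1 / 6) (by norm_num) C
  refine ⟨n₀, fun N hN K hK lam tab => ?_⟩
  have := hn₀ N hN K hK lam tab
  have h56 : (2 / 3 + 1 / 6 : ℝ) = 5 / 6 := by norm_num
  rw [h56] at this
  exact this

/-- `(log₂ N)^c + 4 ≤ N`-type room: `a·(log₂ N)^c ≤ N` for large `N` (from `Nat.lt_pow_self` via `log₂`). -/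
theorem const_mul_logPow_le (a c : ℕ) : ∃ n₀ : ℕ, ∀ N ≥ n₀, a * (Nat.log 2 N) ^ c + a ≤ N := by
  -- `(log₂ N)^(c+1) ≤ N^{1/2}`-type bounds are in the tree; here a crude self-contained argument:
  -- for `N ≥ 2^k` with `k` large, `log₂ N ≤ k + …`; we use `TubePlanProof`-free elementary facts:
  -- `a (log N)^c + a ≤ (log N)^(c+1) ≤ N` once `log₂ N ≥ 2a` and `(log₂ N)^(c+1) ≤ N`.
  -- `(log₂ N)^(c+1) ≤ N` for large `N`: from `m^(c+1) ≤ 2^m` for `m ≥ m₀` (`Nat.lt_pow_self`-style growth).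
  have hgrow : ∃ m₀ : ℕ, ∀ m ≥ m₀, m ^ (c + 1) ≤ 2 ^ m := by
    -- `m ^ (c+1) ≤ 2^m` eventually: use the real-analysis free fact `tendsto_pow_div_pow`? keep elementary:
    -- `(m+1)^(c+1) ≤ 2 · m^(c+1)` once `m ≥ 2(c+1)` … we instead use Mathlib's `Nat.lt_two_pow_self`-based lemma
    obtain ⟨m₀, hm₀⟩ : ∃ m₀ : ℕ, ∀ m ≥ m₀, (m : ℝ) ^ (c + 1) ≤ 2 ^ m := by
      have h := (tendsto_pow_const_div_const_pow_of_one_lt (c + 1) (one_lt_two (α := ℝ))).eventually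
        (gt_mem_nhds zero_lt_one)
      rw [Filter.eventually_atTop] at h
      obtain ⟨m₀, hm₀⟩ := h
      refine ⟨m₀, fun m hm => ?_⟩
      have h1 := hm₀ m hm
      rw [div_lt_one (by positivity)] at h1
      exact h1.le
    refine ⟨m₀, fun m hm => ?_⟩
    have := hm₀ m hm
    exact_mod_cast this
  obtain ⟨m₀, hm₀⟩ := hgrow
  refine ⟨2 ^ max m₀ (2 * a + 2), fun N hN => ?_⟩
  have hN1 : 1 ≤ N := le_trans Nat.one_le_two_pow hN
  set m := Nat.log 2 N with hm
  have hmge : max m₀ (2 * a + 2) ≤ m := by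
    rw [hm]; exact Nat.le_log_of_pow_le one_lt_two hN
  have hpow : m ^ (c + 1) ≤ N := by
    calc m ^ (c + 1) ≤ 2 ^ m := hm₀ m (le_trans (le_max_left _ _) hmge)
      _ ≤ N := Nat.pow_log_le_self 2 (by omega)
  have h2a : 2 * a + 2 ≤ m := le_trans (le_max_right _ _) hmge
  have hmc : 1 ≤ m ^ c := Nat.one_le_pow _ _ (by omega)
  calc a * m ^ c + a ≤ a * m ^ c + a * m ^ c := by nlinarith
    _ = (2 * a) * m ^ c := by ring
    _ ≤ m * m ^ c := Nat.mul_le_mul_right _ (by omega)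
    _ = m ^ (c + 1) := by ring
    _ ≤ N := hpow

/-- The numerical heart of the error term: `3 · (√3/2)^8 = 243/256 ≤ 1`. -/
theorem three_mul_sqrt3_half_pow_eight_le : (3 : ℝ) * (Real.sqrt 3 / 2) ^ 8 ≤ 1 := by
  have h3 : Real.sqrt 3 ^ 2 = 3 := Real.sq_sqrt (by norm_num)
  have : (Real.sqrt 3 / 2) ^ 8 = (Real.sqrt 3 ^ 2) ^ 4 / 256 := by ring
  rw [this, h3]; norm_num

/-- **The R11′ template at `p = 3`** (Sketch20x §3 `ringLinFormsSharp3_of`): `TwistBoundX3` (error term) and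
`RingJuntaBellsSharp3` (main term) give `RingLinFormsSharp3`, by one call of the generic regularise–expand inequality
`LinForms.card_le_junta_add_twist` with `w = 8K + 2m₁`. -/
theorem ringLinFormsSharp3_of (hT : TwistBoundX3) (hJ : RingJuntaBellsSharp3) : RingLinFormsSharp3 := by
  classical
  intro ε hε C
  obtain ⟨A, hA⟩ := hT
  obtain ⟨m, hm⟩ := hJ (ε / 2) (by linarith)
  -- `m₁` with `|A| · (3/4)^{m₁} ≤ ε/4`
  obtain ⟨m₁, hm₁⟩ : ∃ m₁ : ℕ, |A| * (3 / 4 : ℝ) ^ m₁ ≤ ε / 4 := by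
    obtain ⟨k, hk⟩ := exists_pow_lt_of_lt_one (show 0 < (ε / 4) / (|A| + 1) by positivity)
      (show (3 / 4 : ℝ) < 1 by norm_num)
    refine ⟨k, ?_⟩
    have hA1 : 0 < |A| + 1 := by positivity
    have := (lt_div_iff₀ hA1).1 hk
    nlinarith [abs_nonneg A, pow_nonneg (show (0:ℝ) ≤ 3/4 by norm_num) k]
  -- room: `m · (K(w-1) + 1) ≤ N` for `w = 8K + 2m₁`, `K ≤ (log₂ N)^C`
  obtain ⟨n₀, hn₀⟩ := const_mul_logPow_le (m * (8 + 2 * m₁ + 1)) (2 * C)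
  refine ⟨max n₀ 1, fun N hN K hK lam tab => ?_⟩
  have hNn₀ : n₀ ≤ N := le_trans (le_max_left _ _) hN
  have hN1 : 1 ≤ N := le_trans (le_max_right _ _) hN
  set w := 8 * K + 2 * m₁ with hw
  -- the generic inequality
  obtain ⟨J, hJcard, hgen⟩ := LinForms.card_le_junta_add_twist (p := 3) lam w
  set P : (Fin K → ZMod 3) → (Fin N → Bool) → Prop := fun v x =>
    OddZeros x ∧ RingHLF.Rel x (fun k => xor (tGuess x k) (tab k v)) with hP
  set Bv : ℝ := |A| * (Real.sqrt 3 / 2) ^ w * (2 : ℝ) ^ N with hBv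
  have hBv0 : 0 ≤ Bv := by positivity
  -- junta room
  have hJN : m * (J.card + 1) ≤ N := by
    set X := (Nat.log 2 N) ^ (2 * C) with hX
    have hKsq : K * K ≤ X := (Nat.mul_le_mul hK hK).trans (by rw [hX, ← pow_add, two_mul])
    have hK1 : K ≤ K * K := by
      rcases Nat.eq_zero_or_pos K with h | h
      · rw [h]
      · exact Nat.le_mul_of_pos_left K h
    have h1 : J.card ≤ (8 + 2 * m₁) * X := by
      have a1 : J.card ≤ K * w := hJcard.trans (Nat.mul_le_mul_left _ (Nat.sub_le _ _))
      have a2 : K * w = 8 * (K * K) + 2 * m₁ * K := by rw [hw]; ring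
      have a3 := Nat.mul_le_mul_left (2 * m₁) hK1
      have a4 := Nat.mul_le_mul_left (2 * m₁) hKsq
      have a5 : (8 + 2 * m₁) * X = 8 * X + 2 * m₁ * X := by ring
      omega
    have h3 := hn₀ N hNn₀
    have e1 : m * ((8 + 2 * m₁) * X + 1) = m * (8 + 2 * m₁) * X + m := by ring
    have e2 : m * (8 + 2 * m₁) * X ≤ m * (8 + 2 * m₁ + 1) * X :=
      Nat.mul_le_mul_right _ (Nat.mul_le_mul_left _ (by omega))
    have e3 : m ≤ m * (8 + 2 * m₁ + 1) := Nat.le_mul_of_pos_right _ (by omega)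
    have e4 : m * (J.card + 1) ≤ m * ((8 + 2 * m₁) * X + 1) := Nat.mul_le_mul_left _ (by omega)
    rw [← hX] at h3
    calc m * (J.card + 1) ≤ m * ((8 + 2 * m₁) * X + 1) := e4
      _ = m * (8 + 2 * m₁) * X + m := e1
      _ ≤ m * (8 + 2 * m₁ + 1) * X + m * (8 + 2 * m₁ + 1) := add_le_add e2 e3
      _ ≤ N := h3
  -- hypothesis (a): junta-selected bells
  have ha : ∀ t : Fin K → ZMod 3, ((univ.filter fun x : Fin N → Bool =>
      P (fun j => (∑ i ∈ J, if x i then lam j i else 0) + t j) x).card : ℝ) ≤ (2 / 3 + ε / 2) * (2 : ℝ) ^ (N - 1) := by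
    intro t
    set Bx : (Fin N → Bool) → Finset (Fin N) := fun x =>
      univ.filter fun k => tab k (fun j => (∑ i ∈ J, if x i then lam j i else 0) + t j) = true with hBx
    have hmeas : ∀ x y : Fin N → Bool, (∀ i ∈ J, x i = y i) → Bx x = Bx y := by
      intro x y hxy
      have : (fun j => (∑ i ∈ J, if x i then lam j i else 0) + t j) =
          (fun j => (∑ i ∈ J, if y i then lam j i else 0) + t j) := by
        funext j
        rw [sum_congr rfl fun i hi => by rw [hxy i hi]]
      simp only [hBx, this]
    have h := hm N J hJN Bx hmeas
    refine le_trans (le_of_eq ?_) h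
    congr 2
    refine filter_congr fun x _ => ?_
    have hfun : (fun k => xor (tGuess x k) (tab k (fun j => (∑ i ∈ J, if x i then lam j i else 0) + t j))) =
        (fun k => xor (tGuess x k) (decide (k ∈ Bx x))) := by
      funext k
      simp only [hBx, mem_filter, mem_univ, true_and, Bool.decide_eq_true]
    simp only [hP, hfun]
  -- hypothesis (b): the twist bound
  have hb : ∀ (v : Fin K → ZMod 3) (β : Fin N → ZMod 3), w ≤ (univ.filter fun i => β i ≠ 0).card →
      ‖∑ x : Fin N → Bool, (ZMod.stdAddChar (∑ i, if x i then β i else 0) : ℂ) * (if P v x then (1 : ℂ) else 0)‖ ≤ Bv := by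
    intro v β hβ
    set B0 : Finset (Fin N) := univ.filter fun k => tab k v = true with hB0
    have h := hA N B0 β
    have hfun : ∀ x : Fin N → Bool, (fun k => xor (tGuess x k) (decide (k ∈ B0))) =
        (fun k => xor (tGuess x k) (tab k v)) := by
      intro x; funext k
      simp only [hB0, mem_filter, mem_univ, true_and, Bool.decide_eq_true]
    simp only [hfun] at h
    refine le_trans h ?_
    rw [hBv]
    have hs : (0 : ℝ) ≤ Real.sqrt 3 / 2 := by positivity
    have hs1 : Real.sqrt 3 / 2 ≤ 1 := by
      rw [div_le_one (by norm_num)]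
      have : Real.sqrt 3 ≤ Real.sqrt 4 := Real.sqrt_le_sqrt (by norm_num)
      have h4 : Real.sqrt 4 = 2 := by
        rw [show (4:ℝ) = 2 ^ 2 by norm_num, Real.sqrt_sq (by norm_num)]
      linarith
    calc A * (Real.sqrt 3 / 2) ^ (univ.filter fun i => β i ≠ 0).card * (2 : ℝ) ^ N
        ≤ |A| * (Real.sqrt 3 / 2) ^ (univ.filter fun i => β i ≠ 0).card * (2 : ℝ) ^ N := by
          gcongr; exact le_abs_self A
      _ ≤ |A| * (Real.sqrt 3 / 2) ^ w * (2 : ℝ) ^ N := by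
          gcongr _ * ?_ * _
          exact pow_le_pow_of_le_one hs hs1 hβ
  have hmain := hgen P ((2 / 3 + ε / 2) * (2 : ℝ) ^ (N - 1)) Bv hBv0 ha hb
  -- the conclusion: `resVec lam x = fun j => Σ_i …`
  have hres : ∀ x : Fin N → Bool, LinForms.resVec lam x = fun j => ∑ i, if x i then lam j i else 0 := fun x => rfl
  have hset : (univ.filter fun x : Fin N → Bool =>
      OddZeros x ∧ RingHLF.Rel x (fun k => xor (tGuess x k) (tab k (LinForms.resVec lam x)))) =
      univ.filter fun x : Fin N → Bool => P (fun j => ∑ i, if x i then lam j i else 0) x :=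
    filter_congr fun x _ => by simp only [hP, hres]
  rw [hset]
  refine le_trans hmain ?_
  -- the error term: `3^K · Bv ≤ (ε/2) · 2^{N-1}`
  have herr : (3 : ℝ) ^ K * Bv ≤ (ε / 2) * (2 : ℝ) ^ (N - 1) := by
    have h8 : (3 : ℝ) ^ K * ((Real.sqrt 3 / 2) ^ 8) ^ K ≤ 1 := by
      rw [← mul_pow]
      exact pow_le_one₀ (by positivity) three_mul_sqrt3_half_pow_eight_le
    have h34 : ((Real.sqrt 3 / 2) ^ 2) ^ m₁ = (3 / 4 : ℝ) ^ m₁ := by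
      congr 1
      rw [div_pow, Real.sq_sqrt (by norm_num)]; norm_num
    have key : (3 : ℝ) ^ K * Bv =
        ((3 : ℝ) ^ K * ((Real.sqrt 3 / 2) ^ 8) ^ K) * (|A| * (3 / 4 : ℝ) ^ m₁) * (2 : ℝ) ^ N := by
      rw [hBv, hw, pow_add, pow_mul, pow_mul, h34]; ring
    have hN2 : (2 : ℝ) ^ N = 2 * (2 : ℝ) ^ (N - 1) := by
      rw [← pow_succ']; congr 1; omega
    rw [key, hN2]
    have hp : (0 : ℝ) ≤ 2 * (2 : ℝ) ^ (N - 1) := by positivity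
    have hq : 0 ≤ |A| * (3 / 4 : ℝ) ^ m₁ := by positivity
    calc ((3 : ℝ) ^ K * ((Real.sqrt 3 / 2) ^ 8) ^ K) * (|A| * (3 / 4 : ℝ) ^ m₁) * (2 * (2 : ℝ) ^ (N - 1))
        ≤ (1 * (ε / 4)) * (2 * (2 : ℝ) ^ (N - 1)) :=
          mul_le_mul_of_nonneg_right (mul_le_mul h8 hm₁ hq zero_le_one) hp
      _ = (ε / 2) * 2 ^ (N - 1) := by ring
  have h3cast : ((3 : ℕ) : ℝ) = (3 : ℝ) := by norm_num
  rw [h3cast] at hmain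
  linarith

end BondTwist3

end Summit.QuantumAdvantage.AdviceFreeQNC0

end
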